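import Literature.Topology.FourManifolds.Rasmussen
import Literature.Topology.FourManifolds.RasmussenProofs
import Literature.Topology.FourManifolds.LeeRasmussenProofs
import Literature.Topology.FourManifolds.LeeRasmussenReverseProofs
import Literature.Topology.FourManifolds.GaussDiagramsReverseProofs
import Literature.Topology.FourManifolds.KnotsMirrorProofs
import Literature.Topology.FourManifolds.GaussDiagramsRegularPosition
import Literature.Topology.FourManifolds.SliceRibbonUnknotProofs
import Literature.Topology.FourManifolds.SliceGenusZeroProofs
import Literature.Topology.FourManifolds.KnotsProofs
import Literature.Topology.FourManifolds.BandSumConcordanceLeftProofs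
import Literature.Topology.FourManifolds.ConcordanceTransitivity
import Literature.Topology.FourManifolds.RasmussenSliceCanonicalProofs
import Literature.Topology.FourManifolds.BandSumConcordanceRegular
import Literature.Topology.FourManifolds.BandSumFoxMilnorReduction
import Literature.Topology.FourManifolds.LeeRasmussenMirrorDischarge
import Literature.Topology.FourManifolds.GaussDiagramsMirrorProofs
import Literature.Topology.FourManifolds.LeeRasmussenConnSumProofs
import HarnessLib

/-!
# Rasmussen's `s`-invariant: concordance invariance from the slice bound (proofs)

Sibling proof file of `Literature/Topology/FourManifolds/Rasmussen.lean` (next to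
`RasmussenProofs.lean`), home of the proof programme for the named fact
`Literature.Topology.FourManifolds.HasRasmussenInvariant.eq_of_isConcordant` (`Rasmussen.lean`):

> `∀ {K K' : Knot} {s s' : ℤ}, K.HasRasmussenInvariant s → K'.HasRasmussenInvariant s' →
>    K.IsConcordant K' → s = s'`

(concordant knots have the same Rasmussen invariant, i.e. `s` is well defined on the smooth
concordance group `Conc(S³)`).

## The printed proof and what is proved here

Rasmussen, *Khovanov homology and the slice genus* (arXiv: math/0402131; Invent. Math. 182
(2010) 419–447), proof of Thm. 2 (p. 10 of the arXiv version, §4.4): *"If `K₁` and `K₂` are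
concordant, then `K₁ # K̄₂` is slice, so `0 = s(K₁ # K̄₂) = s(K₁) - s(K₂)`. Thus `s` gives a
well-defined map from `Conc(S³)` to `ℤ`."* The ingredients are Thm. 1 (`|s(K)| ≤ 2 g_*(K)`,
hence `s = 0` for slice knots), Prop. 3.11 of the arXiv version (`s(K₁ # K₂) = s(K₁) + s(K₂)`),
Prop. 3.9 (`s(K̄) = -s(K)`) and the Fox–Milnor facts that `K # (-K̄)` is slice and that `#` is
compatible with concordance.

In the tree these ingredients are the named facts `eq_zero_of_isSmoothlySlice` (reduced to
`abs_le_two_mul_sliceGenus` by `eq_zero_of_isSmoothlySlice_of_abs_le_two_mul_sliceGenus`,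
`RasmussenProofs.lean`), `HasRasmussenInvariant.add`, `HasRasmussenInvariant.mirror` /
`HasRasmussenInvariant.reverse` (`Rasmussen.lean`) and
`Knot.isSmoothlySlice_of_isConnectedSum_mirror_reverse` (`BandSum.lean`), together with the
*theorems* `Knot.exists_isConnectedSum_isConcordant_left_holds`
(`BandSumConcordanceLeftProofs.lean`: a concordance `K ~ K'` yields concordant connected sums
`K # M ~ K' # M`), `Knot.isSmoothlySlice_iff_isConcordant_unknot_holds`
(`SliceRibbonUnknotProofs.lean`) and `equivalence_isConcordant_holds`
(`ConcordanceTransitivity.lean`).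

This file proves the printed reduction, i.e. the fact from the named facts it rests on, with no
new named fact (D-0026):

* `Knot.IsConcordant.isSmoothlySlice` — a knot concordant to a smoothly slice knot is smoothly
  slice (from the two `_holds` theorems just quoted);
* `HasRasmussenInvariant.eq_of_isConcordant_of_mirror_reverse` — the core step: given additivity,
  `s = 0` for slice knots and Fox–Milnor, two concordant knots `K ~ K'` with Rasmussen invariants
  `s, s'` have `s = s'` as soon as `M := -K̄' = K'.mirror.reverse` has *some* Rasmussen invariant
  `m` (both `K # M ~ K' # M` and `K' # M` are slice, so `s + m = 0 = s' + m`; this variant of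
  Rasmussen's argument does not use the value `s(K̄') = -s(K')`);
* `HasRasmussenInvariant.eq_of_isConcordant_of_facts` — the fact from additivity, `s = 0` for
  slice knots, Fox–Milnor and the existence of generic projections
  (`Knot.exists_hasGaussDiagram_of_isIsotopic`, which supplies `m`);
* `HasRasmussenInvariant.eq_of_isConcordant_of_facts'` — the fact from additivity, `s = 0` for
  slice knots, Fox–Milnor, mirror and reversal (Rasmussen's proof verbatim: `m = -s'`);
* `HasRasmussenInvariant.eq_of_isConcordant_of_abs_le_two_mul_sliceGenus` — the fact from the
  paper's own results: Thm. 1 (`abs_le_two_mul_sliceGenus`), Prop. 3.11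
  (`HasRasmussenInvariant.add`), Fox–Milnor and generic projections.

Consequences of the fact recorded for its users: uniqueness of `s(K)`
(`HasRasmussenInvariant.unique_of_eq_of_isConcordant`) and isotopy invariance
(`HasRasmussenInvariant.eq_of_isIsotopic_of_eq_of_isConcordant`).

Together with `eq_zero_of_isSmoothlySlice_of_eq_of_isConcordant` (`RasmussenProofs.lean`) this
shows that, modulo additivity, Fox–Milnor and generic projections, the two named facts
`HasRasmussenInvariant.eq_of_isConcordant` and `eq_zero_of_isSmoothlySlice` are equivalent. The
discharge `HasRasmussenInvariant.eq_of_isConcordant_holds` is the one-liner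
`eq_of_isConcordant_of_facts add_holds eq_zero_of_isSmoothlySlice_holds …` once the upstream facts
are discharged; their proofs need the maps on Lee homology induced by link cobordisms
(Rasmussen (2010), §4, Prop. 4.1) and the short exact sequence of a connected sum (§3), not yet
in the tree.

## The direct route (appended 2026-08-15): Rasmussen's §4, Cor. 4.2

Rasmussen's own argument for Thm. 1 runs through the maps induced by cobordisms on Lee
homology (arXiv §4): a cobordism `S` from `K₀` to `K₁`, cut into elementary cobordisms
(Reidemeister moves and Morse moves of a movie, §4.1), induces `φ_S : Kh'(K₀) → Kh'(K₁)`,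
*"a filtered map of degree `χ(S)`"* (§4.2), and *"if `S` is a connected cobordism between knots
`K₀` and `K₁`, then `φ_S` is an isomorphism"* (Cor. 4.2, from Prop. 4.1 and Lee's basis of
canonical generators). For a concordance (`χ(S) = 0`) and a class `x ≠ 0` with `s(x)` maximal
this gives `s_max(K₁) ≥ s(φ_S(x)) ≥ s(x) = s_max(K₀)` (§2.2: the induced filtration on homology),
and symmetrically along the reversed concordance, so `s(K₀) = s(K₁)` — with no connected sum,
no mirror image and no Fox–Milnor argument. The second part of this file isolates, sorry-free,
everything in that argument which does not depend on the (absent) cobordism maps: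

* `GaussDiagram.leeSMax_le_of_filteredClasses` — `s_max` is monotone along any map of
  degree-zero Lee homology classes that kills no nonzero class and does not lower Rasmussen's
  class filtration `classDegree` (the homology-level form of
  `GaussDiagram.leeSMax_le_of_filtered`, `LeeRasmussenProofs.lean`; this is the form §4.2
  delivers, since `φ_S` of an inverse Reidemeister move is filtered only on homology, Lemma 6.2);
* `HasRasmussenInvariant.eq_of_isConcordant_iff_diagram` — the named fact is *equivalent* to
  its diagrammatic core: any two regular projections of any two concordant knots read Gauss
  diagrams with the same `s` (`HasRasmussenInvariant` quantifies over isotopic representatives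
  in regular position, and isotopic knots are concordant, `Knot.IsConcordant.of_isIsotopic_holds`);
* `HasRasmussenInvariant.eq_of_isConcordant_of_filteredClasses` — **the assembly**: the named
  fact follows as soon as every concordance `K ~ K'` between knots in regular position `P`, `P'`
  comes with a map `Kh'⁰(P.diagram) → Kh'⁰(P'.diagram)` killing no nonzero class and not
  lowering `classDegree` (Rasmussen's `φ_S`: Cor. 4.2 and §4.2); one direction per concordance
  suffices because concordance is symmetric (`equivalence_isConcordant_holds`);
* `HasRasmussenInvariant.eq_of_isConcordant_of_filtered` — the same from maps of degree-zero
  Lee *cycles* in the shape consumed by `GaussDiagram.leeSMax_le_of_filtered` (the interface of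
  the sibling assembly `eq_zero_of_isSmoothlySlice_of_filtered`, `RasmussenSliceProofs.lean`,
  which is its special case `K' = unknot`);
* `eq_zero_of_isSmoothlySlice_of_filteredClasses`, `eq_zero_of_isSmoothlySlice_of_filtered'` —
  under either hypothesis the named fact `eq_zero_of_isSmoothlySlice` follows too
  (`eq_zero_of_isSmoothlySlice_of_eq_of_isConcordant`, `RasmussenProofs.lean`).

So both routes to `HasRasmussenInvariant.eq_of_isConcordant_holds` are reduced to Lee-complex
input alone: Route A (above) to the four named facts of Rasmussen's proof of Thm. 2, Route B
(here) to the cobordism maps `φ_S` of concordances, which the tree does not have yet (they live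
on Lee complexes of *link* diagrams; `GaussDiagram` is knots-only).

## Discharge of `HasRasmussenInvariant.reverse` (appended 2026-08-15)

The last part discharges one of the named facts Route A rests on:

* `HasRasmussenInvariant.reverse_holds` — **`s(rK) = s(K)`**, the named fact
  `HasRasmussenInvariant.reverse` of `Rasmussen.lean` (Rasmussen (2010), §3.5): a witness
  `K ≅ K'`, `K'` in regular position reading `D`, is reversed to `rK ≅ rK'`
  (`SphereEmbedding.IsIsotopic.reverse`, `KnotsMirrorProofs.lean`), `rK'` in regular position
  reading `D.reverse` (`Knot.HasGaussDiagram.reverse_holds`, `GaussDiagramsReverseProofs.lean`),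
  and `s(D.reverse) = s(D)` (`GaussDiagram.rasmussenInvariant_reverse`,
  `LeeRasmussenReverseProofs.lean`: the cube of resolutions of a Gauss diagram is invariant under
  reversal of the base circle);
* `HasRasmussenInvariant.eq_of_isConcordant_of_facts''` — Route A with reversal discharged: the
  named fact from additivity, `s = 0` for slice knots, Fox–Milnor and the mirror formula;
* `HasRasmussenInvariant.eq_of_isConcordant_of_add_of_slice_of_foxMilnor` — Route A with generic
  projections discharged (`Knot.exists_hasGaussDiagram_of_isIsotopic_holds`,
  `GaussDiagramsRegularPosition.lean`): **the named fact now rests on exactly three named facts**,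
  additivity (`HasRasmussenInvariant.add`), `s = 0` for smoothly slice knots
  (`eq_zero_of_isSmoothlySlice`) and Fox–Milnor
  (`Knot.isSmoothlySlice_of_isConnectedSum_mirror_reverse`); the discharge
  `eq_of_isConcordant_holds` is this theorem fed with their three `_holds`.

## Hedged assemblies (appended 2026-08-15, third instalment): regular presentations, chain maps

Two further assemblies keep the discharge one line away from whichever form the upstream results
land in.

* `HasRasmussenInvariant.eq_of_isConcordant_of_regular` — **Route A for the printed (regular)
  connected sum.** The corner-free presentations `Knot.IsConnectedSum` of `BandSum.lean` (band
  controlled on the open collar only) are wider than the printed product of knots along an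
  embedded closed rectangle (Cromwell (2004), §4.6), which is `Knot.IsRegularConnectedSum`
  (`SchubertRegular.lean`); the corner-free band facts were deprecated as mis-stated
  (`BandSum.lean`, 2026-08-15) and the Fox–Milnor programme records the printed reading of its
  fact with regular witnesses (`BandSumFoxMilnorReduction.lean`:
  `Knot.isSmoothlySlice_of_isRegularConnectedSum_mirror_reverse_of…`). Since the carrying
  construction now produces *regular normal* presentations
  (`Knot.exists_isRegularNormalConnectedSum_isConcordant_left`, `BandSumConcordanceNormalRegular.lean`,
  proved; `Knot.IsRegularNormalConnectedSum.isRegularConnectedSum`, `BandSumConcordanceRegular.lean`),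
  Route A goes through with additivity and Fox–Milnor assumed **for regular presentations only**:
  the named fact follows from (i) `s(K₁ # K₂) = s(K₁) + s(K₂)` for regular connected sums,
  (ii) `eq_zero_of_isSmoothlySlice` and (iii) "every regular connected sum of `K` and `-K̄` is
  smoothly slice" (`eq_of_isConcordant_of_mirror_reverse_regular`, `…_of_regular`; `…_of_regular'`
  takes the slice bound `abs_le_two_mul_sliceGenus` for (ii)). The facts as stated imply (i) and
  (iii) (`HasRasmussenInvariant.add_regular_of_add`,
  `Knot.isSmoothlySlice_of_isRegularConnectedSum_mirror_reverse_of_general`), so this route is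
  weaker in hypothesis than `eq_of_isConcordant_of_add_of_slice_of_foxMilnor`, which it recovers
  (`eq_of_isConcordant_of_add_of_slice_of_foxMilnor'`).
* `HasRasmussenInvariant.eq_of_isConcordant_of_canonical` — **Route B at the chain level**, in the
  currency of `eq_zero_of_isSmoothlySlice_of_canonical` (`RasmussenSliceCanonicalProofs.lean`): the
  named fact follows as soon as every concordance `K ~ K'` between knots in regular position `P`,
  `P'` comes with a linear map of degree-zero Lee chains `C⁰(P.diagram) → C⁰(P'.diagram)` mapping
  cycles to cycles and boundaries to boundaries, not decreasing `qMin` (filtered of degree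
  `χ(S) = 0`, §4.2) and carrying each canonical generator to a nonzero multiple of a canonical
  generator modulo boundaries, injectively on canonical states (the claim in the proof of
  Prop. 4.1) — Rasmussen's chain map `φ_S` *before* passing to homology. Injectivity on homology is
  then Corollary 4.2 in the form `GaussDiagram.mk_eq_zero_of_canonical` (which rests on Lee's
  theorem, meanwhile proved: `finrank_leeHomologyZero_eq_two_holds`, `LeeRasmussenRankHolds.lean`),
  and `eq_of_isConcordant_of_filtered` concludes; one map per concordance suffices (symmetry of
  concordance). The same hypothesis yields `eq_zero_of_isSmoothlySlice`
  (`eq_zero_of_isSmoothlySlice_of_canonical'`).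

## Route A in normal position; additivity in existential form (appended 2026-08-15, fourth instalment)

The Fox–Milnor programme has since isolated the reading of its fact that Route A consumes and
that needs no Schoenflies theorem: for **regular normal** presentations
(`Knot.IsRegularNormalConnectedSum`, `SchubertRegular.lean`) every presentation of
`K # K.mirror.reverse` is smoothly slice, granted the symmetric union (A) and Schubert's theorem
in normal position for regular presentations, `Knot.Schubert1949_normalPosition_regular`
(`Knot.isSmoothlySlice_of_isRegularNormalConnectedSum_mirror_reverse_of_normalPosition_regular`,
`BandSumFoxMilnorReduction.lean`). The fourth part runs Route A in that position and, using that
`Knot.HasRasmussenInvariant` is closed under isotopy by definition, weakens the additivity input to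
its **existential form** — *some* regular normal presentation of `K₁ # K₂` has Rasmussen invariant
`s₁ + s₂` — which is what the printed proof of Prop. 3.11 delivers (one diagram of `K₁ # K₂`
drawn from diagrams of the summands; arXiv math/0402131, Lemma 3.8 and Prop. 3.11, p. 7) and
involves neither Schubert's theorem nor the Reidemeister invariance of `s`:

* `HasRasmussenInvariant.eq_of_isConcordant_of_regularNormal` — the fact from additivity and
  Fox–Milnor over regular normal presentations and `eq_zero_of_isSmoothlySlice` (core
  `…_of_mirror_reverse_regularNormal`; it recovers the regular route,
  `eq_of_isConcordant_of_regular_of_normal`);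
* `HasRasmussenInvariant.add_regularNormal_of_exists_add_of_normalPosition_regular` /
  `exists_add_of_add_regularNormal` — granted `Knot.Schubert1949_normalPosition_regular`,
  additivity over all regular normal presentations is equivalent to its existential form;
* `HasRasmussenInvariant.eq_of_isConcordant_of_exists_add_of_symmetric_of_normalPosition_regular`
  (and `…_of_rebuilt`, `…_of_sliceBound_…`) — **the fact from existential additivity,
  `eq_zero_of_isSmoothlySlice` (or `abs_le_two_mul_sliceGenus`), the symmetric union (A) with a
  regular normal witness, and the single named fact `Knot.Schubert1949_normalPosition_regular`**
  (equivalently the heart `Knot.Schubert1949_normalPosition_rebuilt`, the printed band fact being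
  proved, `BandData.isIsotopic_of_band_eq_of_isRegular_holds`);
* `HasRasmussenInvariant.eq_of_isConcordant_of_add_of_slice_of_foxMilnor_of_normalPosition_regular`
  — the named facts as stated feed this route too.

## Discharge of `HasRasmussenInvariant.mirror` (appended 2026-08-15, fifth instalment)

* `HasRasmussenInvariant.mirror_holds` — **`s(K̄) = -s(K)`**, the named fact
  `HasRasmussenInvariant.mirror` of `Rasmussen.lean` (Rasmussen (2010), Prop. 3.9 of the arXiv
  version): a witness `K ≅ K'`, `K'` in regular position reading `D`, is mirrored to `K̄ ≅ K̄'`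
  (`SphereEmbedding.IsIsotopic.mirror`, `KnotsMirrorProofs.lean`), `K̄'` is isotopic to a knot in
  regular position reading `D.mirror` (`Knot.HasGaussDiagram.mirror_holds`,
  `GaussDiagramsMirrorProofs.lean`), and `s(D.mirror) = -s(D)`
  (`GaussDiagram.rasmussenInvariant_mirror_holds`, `LeeRasmussenMirrorDischarge.lean`);
* `HasRasmussenInvariant.mirror_reverse` — `s(-K̄) = -s(K)` for the concordance inverse
  `-K̄ = rK̄`, the value `m = -s'` of the core step of Route A (printed form
  `0 = s(K # -K̄') = s(K) - s(K')`).

With this, of the five named facts of `Rasmussen.lean` entering the printed proof, `mirror` and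
`reverse` are theorems; additivity, Thm. 1 for slice knots and Fox–Milnor remain.

## References

* J. Rasmussen, *Khovanov homology and the slice genus*, Invent. Math. 182 (2010) 419–447;
  arXiv: math/0402131, §4.4, proof of Thm. 2 (p. 10); Thm. 1; Prop. 3.9, Prop. 3.11.
  [Rasmussen2010]
* R. H. Fox, J. W. Milnor, *Singularities of 2-spheres in 4-space and cobordism of knots*,
  Osaka J. Math. 3 (1966), 257–267, §1. [FoxMilnor1966]
* P. R. Cromwell, *Knots and Links*, Cambridge University Press (2004), §4.6 (the product of
  knots along an embedded rectangle). [Cromwell2004]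
* E. S. Lee, *An endomorphism of the Khovanov invariant*, Adv. Math. 197 (2005) 554–586,
  Thm. 4.2. [Lee2005]

## Design notes

* No statement of another file is modified; no new `def … : Prop`; no `sorry`.
* The instance binders `[SphereEmbedding.SmoothnessFacts]` of `Knot.mirror`, `Knot.reverse`,
  `unknot` are discharged by the tree's instance `SphereEmbedding.smoothnessFacts`
  (`KnotsProofs.lean`), symmetry/transitivity of isotopy by `SphereEmbedding.isotopyFacts`
  (`KnotsIsotopyProofs.lean`), both imported transitively.
-/

noncomputable section

namespace Literature.Topology.FourManifolds

section SPC4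

/-- A knot concordant to a smoothly slice knot is smoothly slice (slice `⟺` concordant to the
unknot, `Knot.isSmoothlySlice_iff_isConcordant_unknot_holds`, and transitivity of concordance,
`equivalence_isConcordant_holds`). Fox–Milnor (1966), §1; Livingston (2005), §2.1.
[cite: FoxMilnor1966, §1] -/
theorem Knot.IsConcordant.isSmoothlySlice {K K' : Knot} (h : K.IsConcordant K')
    (hK' : K'.IsSmoothlySlice) : K.IsSmoothlySlice :=
  Knot.isSmoothlySlice_iff_isConcordant_unknot_holds.2
    (equivalence_isConcordant_holds.trans h
      (Knot.isSmoothlySlice_iff_isConcordant_unknot_holds.1 hK'))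

/-- **Core of Rasmussen's proof that `s` is a concordance invariant** (proof of Thm. 2, first
half, arXiv math/0402131 §4.4), from the named facts it rests on: additivity of `s` under
connected sum (`HasRasmussenInvariant.add`, Rasmussen Prop. 3.11/Thm. 2), vanishing of `s` on
smoothly slice knots (`eq_zero_of_isSmoothlySlice`, Rasmussen Thm. 1) and Fox–Milnor's
`K # (-K̄)` is slice (`Knot.isSmoothlySlice_of_isConnectedSum_mirror_reverse`). If `K ~ K'` are
concordant with Rasmussen invariants `s`, `s'`, and `M := K'.mirror.reverse = -K̄'` has a Rasmussen
invariant `m`, then `s = s'`: by `Knot.exists_isConnectedSum_isConcordant_left_holds` there are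
concordant connected sums `L = K # M ~ L' = K' # M`; `L'` is slice (Fox–Milnor), hence so is `L`
(`Knot.IsConcordant.isSmoothlySlice`), and additivity plus the slice vanishing give
`s + m = 0 = s' + m`. (Rasmussen's text uses `m = -s'`; this form needs no value of `m`.)
[cite: Rasmussen2010, Thm. 2 (proof, §4.4)] -/
theorem HasRasmussenInvariant.eq_of_isConcordant_of_mirror_reverse
    (hadd : HasRasmussenInvariant.add) (h0 : eq_zero_of_isSmoothlySlice)
    (hFM : Knot.isSmoothlySlice_of_isConnectedSum_mirror_reverse)
    {K K' : Knot} {s s' m : ℤ} (h : K.HasRasmussenInvariant s)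
    (h' : K'.HasRasmussenInvariant s') (hm : K'.mirror.reverse.HasRasmussenInvariant m)
    (hc : K.IsConcordant K') : s = s' := by
  obtain ⟨L, L', hL, hL', hLL'⟩ :=
    Knot.exists_isConnectedSum_isConcordant_left_holds K'.mirror.reverse hc
  have hL's : L'.IsSmoothlySlice := hFM hL'
  have hLs : L.IsSmoothlySlice := hLL'.isSmoothlySlice hL's
  have e₁ : s + m = 0 := h0 (hadd h hm hL) hLs
  have e₂ : s' + m = 0 := h0 (hadd h' hm hL') hL's
  omega

/-- **`s` is a concordance invariant, from the named facts of Rasmussen's proof** (arXiv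
math/0402131, proof of Thm. 2, §4.4): additivity (`HasRasmussenInvariant.add`), `s = 0` for
smoothly slice knots (`eq_zero_of_isSmoothlySlice`), Fox–Milnor
(`Knot.isSmoothlySlice_of_isConnectedSum_mirror_reverse`) and the existence of generic
projections (`Knot.exists_hasGaussDiagram_of_isIsotopic`, supplying a Rasmussen invariant of
`-K̄'`) imply `HasRasmussenInvariant.eq_of_isConcordant`. The discharge
`eq_of_isConcordant_holds` is this theorem fed with the four `_holds`.
[cite: Rasmussen2010, Thm. 2 (proof, §4.4)] -/
theorem HasRasmussenInvariant.eq_of_isConcordant_of_facts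
    (hadd : HasRasmussenInvariant.add) (h0 : eq_zero_of_isSmoothlySlice)
    (hFM : Knot.isSmoothlySlice_of_isConnectedSum_mirror_reverse)
    (hex : Knot.exists_hasGaussDiagram_of_isIsotopic) :
    HasRasmussenInvariant.eq_of_isConcordant := by
  intro K K' s s' h h' hc
  obtain ⟨M', D, hM', hD⟩ := hex K'.mirror.reverse
  exact HasRasmussenInvariant.eq_of_isConcordant_of_mirror_reverse hadd h0 hFM h h'
    ⟨M', D, hM', hD, rfl⟩ hc

/-- **`s` is a concordance invariant, Rasmussen's proof verbatim** (arXiv math/0402131, proof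
of Thm. 2, §4.4: *"if `K₁` and `K₂` are concordant, then `K₁ # K̄₂` is slice, so
`0 = s(K₁ # K̄₂) = s(K₁) - s(K₂)`"*): additivity (`HasRasmussenInvariant.add`), `s = 0` for
smoothly slice knots (`eq_zero_of_isSmoothlySlice`), Fox–Milnor
(`Knot.isSmoothlySlice_of_isConnectedSum_mirror_reverse`), the mirror formula
`s(K̄) = -s(K)` (`HasRasmussenInvariant.mirror`, Prop. 3.9) and invariance under reversal
(`HasRasmussenInvariant.reverse`, §3.5) imply `HasRasmussenInvariant.eq_of_isConcordant`.
[cite: Rasmussen2010, Thm. 2 (proof, §4.4)] -/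
theorem HasRasmussenInvariant.eq_of_isConcordant_of_facts'
    (hadd : HasRasmussenInvariant.add) (h0 : eq_zero_of_isSmoothlySlice)
    (hFM : Knot.isSmoothlySlice_of_isConnectedSum_mirror_reverse)
    (hmirror : HasRasmussenInvariant.mirror) (hrev : HasRasmussenInvariant.reverse) :
    HasRasmussenInvariant.eq_of_isConcordant := by
  intro K K' s s' h h' hc
  exact HasRasmussenInvariant.eq_of_isConcordant_of_mirror_reverse hadd h0 hFM h h'
    (hrev (hmirror h')) hc

/-- **`s` is a concordance invariant, from the paper's own results**: Rasmussen's slice bound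
`|s(K)| ≤ 2 g₄(K)` (`abs_le_two_mul_sliceGenus`, Thm. 1), additivity
(`HasRasmussenInvariant.add`, Prop. 3.11), Fox–Milnor
(`Knot.isSmoothlySlice_of_isConnectedSum_mirror_reverse`) and generic projections
(`Knot.exists_hasGaussDiagram_of_isIsotopic`) imply `HasRasmussenInvariant.eq_of_isConcordant`:
a smoothly slice knot has `g₄ = 0` (`Knot.sliceGenus_eq_zero_of_isSmoothlySlice`,
`SliceGenusZeroProofs.lean`), so Thm. 1 gives `s = 0` on slice knots (the same step as
`eq_zero_of_isSmoothlySlice_of_abs_le_two_mul_sliceGenus` of `RasmussenProofs.lean`).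
Rasmussen (2010), Thm. 1, Thm. 2. [cite: Rasmussen2010, Thm. 2 (proof, §4.4)] -/
theorem HasRasmussenInvariant.eq_of_isConcordant_of_abs_le_two_mul_sliceGenus
    (h2g : abs_le_two_mul_sliceGenus) (hadd : HasRasmussenInvariant.add)
    (hFM : Knot.isSmoothlySlice_of_isConnectedSum_mirror_reverse)
    (hex : Knot.exists_hasGaussDiagram_of_isIsotopic) :
    HasRasmussenInvariant.eq_of_isConcordant := by
  refine HasRasmussenInvariant.eq_of_isConcordant_of_facts hadd (fun {K s} h hs ↦ ?_) hFM hex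
  -- a smoothly slice knot has `g₄ = 0` (`Knot.sliceGenus_eq_zero_of_isSmoothlySlice`), so the
  -- slice bound reads `|s| ≤ 0`
  have hle : |s| ≤ 2 * (K.sliceGenus : ℤ) := h2g h
  rw [Knot.sliceGenus_eq_zero_of_isSmoothlySlice hs, Nat.cast_zero, mul_zero] at hle
  exact abs_nonpos_iff.1 hle

/-! ## Consequences of the fact: uniqueness and isotopy invariance of `s` -/

/-- Concordance invariance of `s` (`HasRasmussenInvariant.eq_of_isConcordant`, hypothesis `hci`)
contains the **uniqueness of the Rasmussen invariant** of a knot (concordance is reflexive,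
`Knot.IsConcordant.refl'`), i.e. the uniqueness half of
`Knot.existsUnique_hasRasmussenInvariant` without the named facts `Knot.reidemeister` and
`GaussDiagram.rasmussenInvariant_eq_of_equiv` used there. Rasmussen (2010), Thm. 1 (`s(K)` is
an invariant of `K`). [cite: Rasmussen2010, Thm. 1] -/
theorem HasRasmussenInvariant.unique_of_eq_of_isConcordant
    (hci : HasRasmussenInvariant.eq_of_isConcordant) {K : Knot} {s s' : ℤ}
    (h : K.HasRasmussenInvariant s) (h' : K.HasRasmussenInvariant s') : s = s' :=
  hci h h' (Knot.IsConcordant.refl' K)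

/-- Concordance invariance of `s` (`HasRasmussenInvariant.eq_of_isConcordant`, hypothesis `hci`)
contains its **isotopy invariance**: isotopic knots are concordant
(`Knot.IsConcordant.of_isIsotopic_holds`, the trace of an ambient isotopy), hence have the same
Rasmussen invariant. Rasmussen (2010), Thm. 1. [cite: Rasmussen2010, Thm. 1] -/
theorem HasRasmussenInvariant.eq_of_isIsotopic_of_eq_of_isConcordant
    (hci : HasRasmussenInvariant.eq_of_isConcordant) {K K' : Knot} {s s' : ℤ}
    (h : K.HasRasmussenInvariant s) (h' : K'.HasRasmussenInvariant s') (hK : K.IsIsotopic K') :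
    s = s' :=
  hci h h' (Knot.IsConcordant.of_isIsotopic_holds hK)

end SPC4

/-! ## The direct route (Rasmussen (2010), §4, Cor. 4.2): filtered maps on Lee homology -/

namespace GaussDiagram

variable {G G' : GaussDiagram}

/-- **`s_max` is monotone along filtered, class-injective maps on Lee homology.** If
`Φ : Kh'⁰(G) → Kh'⁰(G')` is any map of degree-zero Lee homology classes which kills no nonzero
class and does not lower Rasmussen's filtration degree of nonzero classes
(`classDegree α ≤ classDegree (Φ α)`), then `s_max(G) ≤ s_max(G')`: `s_max` is the supremum of
`classDegree` over nonzero classes (Def. 3.1). This is the homology-level form of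
`leeSMax_le_of_filtered` and exactly what Rasmussen's cobordism map of a concordance provides:
*"`φ_S` is a filtered map of degree `χ(S)`"* on `Kh'` (§4.2; for inverse Reidemeister moves only
on homology, Lemma 6.2) and an isomorphism for a connected cobordism between knots (Cor. 4.2).
Rasmussen (2010), §2.2, Def. 3.1, §4.2. [cite: Rasmussen2010, §2.2] -/
theorem leeSMax_le_of_filteredClasses (Φ : G.LeeHomologyZero → G'.LeeHomologyZero)
    (hinj : ∀ α, Φ α = 0 → α = 0) (hfilt : ∀ α, α ≠ 0 → classDegree α ≤ classDegree (Φ α)) :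
    G.leeSMax ≤ G'.leeSMax :=
  iSup₂_le fun α hα ↦ (hfilt α hα).trans (le_iSup₂_of_le (Φ α) (fun h ↦ hα (hinj α h)) le_rfl)

/-- **Filtered, class-injective maps on Lee homology in both directions pin down `s`.** Under
the hypotheses of `leeSMax_le_of_filteredClasses` for maps `Kh'⁰(G) → Kh'⁰(G')` and
`Kh'⁰(G') → Kh'⁰(G)`, the two Gauss diagrams have the same `s_max`, hence the same Rasmussen
invariant `s = s_max - 1` (Def. 3.4). For a concordance `S` these are Rasmussen's `φ_S` and
`φ_{S̄}` (Cor. 4.2). Rasmussen (2010), Def. 3.4, §4.2, Cor. 4.2. [cite: Rasmussen2010, Cor. 4.2] -/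
theorem rasmussenInvariant_eq_of_filteredClasses (Φ : G.LeeHomologyZero → G'.LeeHomologyZero)
    (Ψ : G'.LeeHomologyZero → G.LeeHomologyZero)
    (hΦ : ∀ α, Φ α = 0 → α = 0) (hΦq : ∀ α, α ≠ 0 → classDegree α ≤ classDegree (Φ α))
    (hΨ : ∀ β, Ψ β = 0 → β = 0) (hΨq : ∀ β, β ≠ 0 → classDegree β ≤ classDegree (Ψ β)) :
    G.rasmussenInvariant = G'.rasmussenInvariant := by
  rw [rasmussenInvariant, rasmussenInvariant, le_antisymm (leeSMax_le_of_filteredClasses Φ hΦ hΦq)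
    (leeSMax_le_of_filteredClasses Ψ hΨ hΨq)]

end GaussDiagram

section SPC4Direct

/-- **The named fact read on diagrams.** Concordance invariance of `s`
(`HasRasmussenInvariant.eq_of_isConcordant`, hypothesis `hci`) says in particular that any
regular projections `P`, `P'` of concordant knots `K ~ K'` read Gauss diagrams with the same
Rasmussen invariant (each knot is isotopic to itself, `SphereEmbedding.IsIsotopic.refl`).
Rasmussen (2010), Thm. 1 (`s(K)` is read on any diagram of `K`, Def. 3.4). [cite: Rasmussen2010, Thm. 1] -/
theorem HasRasmussenInvariant.rasmussenInvariant_eq_of_isConcordant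
    (hci : HasRasmussenInvariant.eq_of_isConcordant) {K K' : Knot} (P : K.RegularProjection)
    (P' : K'.RegularProjection) (hc : K.IsConcordant K') :
    P.diagram.rasmussenInvariant = P'.diagram.rasmussenInvariant :=
  hci ⟨K, P.diagram, SphereEmbedding.IsIsotopic.refl _, ⟨P, rfl⟩, rfl⟩
    ⟨K', P'.diagram, SphereEmbedding.IsIsotopic.refl _, ⟨P', rfl⟩, rfl⟩ hc

/-- **Reduction of `HasRasmussenInvariant.eq_of_isConcordant` to knots in regular position.**
If any two regular projections of any two concordant knots read Gauss diagrams with the same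
Rasmussen invariant, then the named fact holds: witnesses of `K.HasRasmussenInvariant s` and
`K'.HasRasmussenInvariant s'` are regular projections `P`, `P'` of knots `K₁`, `K₁'` isotopic to
`K`, `K'`, and `K₁ ~ K ~ K' ~ K₁'` are concordant since isotopic knots are concordant
(`Knot.IsConcordant.of_isIsotopic_holds`, the trace of an ambient isotopy) and concordance is an
equivalence relation (`equivalence_isConcordant_holds`). Rasmussen (2010), Thm. 1; Fox–Milnor
(1966), §1 (concordance is an equivalence relation refining isotopy). [cite: Rasmussen2010, Thm. 1] -/
theorem HasRasmussenInvariant.eq_of_isConcordant_of_diagram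
    (h : ∀ {K K' : Knot} (P : K.RegularProjection) (P' : K'.RegularProjection),
      K.IsConcordant K' → P.diagram.rasmussenInvariant = P'.diagram.rasmussenInvariant) :
    HasRasmussenInvariant.eq_of_isConcordant := by
  rintro K K' s s' ⟨K₁, D, hK₁, ⟨P, rfl⟩, rfl⟩ ⟨K₁', D', hK₁', ⟨P', rfl⟩, rfl⟩ hc
  exact h P P' (equivalence_isConcordant_holds.trans
    (equivalence_isConcordant_holds.symm (Knot.IsConcordant.of_isIsotopic_holds hK₁))
    (equivalence_isConcordant_holds.trans hc (Knot.IsConcordant.of_isIsotopic_holds hK₁')))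

/-- **`HasRasmussenInvariant.eq_of_isConcordant` is equivalent to its diagrammatic core**: the
named fact holds if and only if any two regular projections of any two concordant knots read
Gauss diagrams with the same Rasmussen invariant
(`HasRasmussenInvariant.eq_of_isConcordant_of_diagram` and
`HasRasmussenInvariant.rasmussenInvariant_eq_of_isConcordant`). Rasmussen (2010), Thm. 1.
[cite: Rasmussen2010, Thm. 1] -/
theorem HasRasmussenInvariant.eq_of_isConcordant_iff_diagram :
    HasRasmussenInvariant.eq_of_isConcordant ↔
      ∀ {K K' : Knot} (P : K.RegularProjection) (P' : K'.RegularProjection),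
        K.IsConcordant K' → P.diagram.rasmussenInvariant = P'.diagram.rasmussenInvariant :=
  ⟨fun hci _ _ P P' hc ↦
      HasRasmussenInvariant.rasmussenInvariant_eq_of_isConcordant hci P P' hc,
    fun h ↦ HasRasmussenInvariant.eq_of_isConcordant_of_diagram h⟩

/-- **The assembly of Rasmussen's direct argument (§4, Cor. 4.2), homology level.** Suppose
that for every concordance `K ~ K'` between knots in regular position `P`, `P'` there is a map
`Φ : Kh'⁰(P.diagram) → Kh'⁰(P'.diagram)` of degree-zero Lee homology classes which kills no
nonzero class and does not lower the filtration degree `classDegree` of nonzero classes — in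
Rasmussen's proof, the map `φ_S` induced by the concordance `S` presented as a movie of
Reidemeister and Morse moves: *"a filtered map of degree `χ(S)`"* `= 0` (§4.2, with Lemma 6.2
for the inverse Reidemeister moves) and *"if `S` is a connected cobordism between knots, `φ_S`
is an isomorphism"* (Cor. 4.2, from Prop. 4.1 and Lee's basis `{[𝔰_o], [𝔰_ō]}`, §2.4). Then
concordant knots have the same Rasmussen invariant, i.e. the named fact
`HasRasmussenInvariant.eq_of_isConcordant` holds: `s_max(P) ≤ s_max(P')`
(`GaussDiagram.leeSMax_le_of_filteredClasses`) and, concordance being symmetric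
(`equivalence_isConcordant_holds`), conversely; then
`HasRasmussenInvariant.eq_of_isConcordant_of_diagram`. One map per concordance suffices.
Rasmussen (2010), Thm. 1, §4.2, Cor. 4.2 (arXiv:math/0402131, pp. 8–9).
[cite: Rasmussen2010, Cor. 4.2] -/
theorem HasRasmussenInvariant.eq_of_isConcordant_of_filteredClasses
    (h : ∀ {K K' : Knot} (P : K.RegularProjection) (P' : K'.RegularProjection),
      K.IsConcordant K' →
      ∃ Φ : P.diagram.LeeHomologyZero → P'.diagram.LeeHomologyZero,
        (∀ α, Φ α = 0 → α = 0) ∧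
        (∀ α, α ≠ 0 → GaussDiagram.classDegree α ≤ GaussDiagram.classDegree (Φ α))) :
    HasRasmussenInvariant.eq_of_isConcordant := by
  refine HasRasmussenInvariant.eq_of_isConcordant_of_diagram fun P P' hc ↦ ?_
  obtain ⟨Φ, hΦ, hΦq⟩ := h P P' hc
  obtain ⟨Ψ, hΨ, hΨq⟩ := h P' P (equivalence_isConcordant_holds.symm hc)
  exact GaussDiagram.rasmussenInvariant_eq_of_filteredClasses Φ Ψ hΦ hΦq hΨ hΨq

/-- **The assembly of Rasmussen's direct argument (§4, Cor. 4.2), cycle level.** Suppose that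
for every concordance `K ~ K'` between knots in regular position `P`, `P'` there is a map of
degree-zero Lee cycles `φ : Z⁰(P.diagram) → Z⁰(P'.diagram)` which kills no nonzero homology
class and does not decrease the filtration degree `qMin` (the shape consumed by
`GaussDiagram.leeSMax_le_of_filtered`; `φ` need not be additive, so a filtered, class-injective
map on homology yields one by choosing best representatives). Then the named fact
`HasRasmussenInvariant.eq_of_isConcordant` holds: `s_max(P) ≤ s_max(P')` and conversely along the
reversed concordance (`equivalence_isConcordant_holds`), so `s(P) = s(P')`, and
`HasRasmussenInvariant.eq_of_isConcordant_of_diagram` concludes. The sibling assembly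
`eq_zero_of_isSmoothlySlice_of_filtered` (`RasmussenSliceProofs.lean`) is the case `K' = U` with
its crossingless projection. Rasmussen (2010), Thm. 1, §2.2, §4.2, Cor. 4.2.
[cite: Rasmussen2010, Cor. 4.2] -/
theorem HasRasmussenInvariant.eq_of_isConcordant_of_filtered
    (h : ∀ {K K' : Knot} (P : K.RegularProjection) (P' : K'.RegularProjection),
      K.IsConcordant K' →
      ∃ φ : P.diagram.leeCycles → P'.diagram.leeCycles,
        (∀ z : P.diagram.leeCycles,
          (Submodule.Quotient.mk (φ z) : P'.diagram.LeeHomologyZero) = 0 →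
          (Submodule.Quotient.mk z : P.diagram.LeeHomologyZero) = 0) ∧
        (∀ z : P.diagram.leeCycles, GaussDiagram.qMin z.1 ≤ GaussDiagram.qMin (φ z).1)) :
    HasRasmussenInvariant.eq_of_isConcordant := by
  refine HasRasmussenInvariant.eq_of_isConcordant_of_diagram fun P P' hc ↦ ?_
  obtain ⟨φ, hφ, hφq⟩ := h P P' hc
  obtain ⟨ψ, hψ, hψq⟩ := h P' P (equivalence_isConcordant_holds.symm hc)
  rw [GaussDiagram.rasmussenInvariant, GaussDiagram.rasmussenInvariant,
    le_antisymm (GaussDiagram.leeSMax_le_of_filtered φ hφ hφq)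
      (GaussDiagram.leeSMax_le_of_filtered ψ hψ hψq)]

/-- **Slice knots have `s = 0`, from the cobordism maps of concordances (homology level).**
Under the hypothesis of `HasRasmussenInvariant.eq_of_isConcordant_of_filteredClasses` the named
fact `eq_zero_of_isSmoothlySlice` holds as well: a smoothly slice knot is concordant to the
unknot, which has `s = 0` (`eq_zero_of_isSmoothlySlice_of_eq_of_isConcordant`,
`RasmussenProofs.lean`). Rasmussen (2010), Thm. 1 (case `g = 0`), §4.4.
[cite: Rasmussen2010, Thm. 1] -/
theorem eq_zero_of_isSmoothlySlice_of_filteredClasses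
    (h : ∀ {K K' : Knot} (P : K.RegularProjection) (P' : K'.RegularProjection),
      K.IsConcordant K' →
      ∃ Φ : P.diagram.LeeHomologyZero → P'.diagram.LeeHomologyZero,
        (∀ α, Φ α = 0 → α = 0) ∧
        (∀ α, α ≠ 0 → GaussDiagram.classDegree α ≤ GaussDiagram.classDegree (Φ α))) :
    eq_zero_of_isSmoothlySlice :=
  eq_zero_of_isSmoothlySlice_of_eq_of_isConcordant
    (HasRasmussenInvariant.eq_of_isConcordant_of_filteredClasses h)

/-- **Slice knots have `s = 0`, from the cobordism maps of concordances (cycle level).** Under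
the hypothesis of `HasRasmussenInvariant.eq_of_isConcordant_of_filtered` the named fact
`eq_zero_of_isSmoothlySlice` holds as well (`eq_zero_of_isSmoothlySlice_of_eq_of_isConcordant`,
`RasmussenProofs.lean`); compare `eq_zero_of_isSmoothlySlice_of_filtered`
(`RasmussenSliceProofs.lean`), which asks for the maps only to and from the crossingless unknot
diagram but in both directions. Rasmussen (2010), Thm. 1 (case `g = 0`), §4.4.
[cite: Rasmussen2010, Thm. 1] -/
theorem eq_zero_of_isSmoothlySlice_of_filtered'
    (h : ∀ {K K' : Knot} (P : K.RegularProjection) (P' : K'.RegularProjection),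
      K.IsConcordant K' →
      ∃ φ : P.diagram.leeCycles → P'.diagram.leeCycles,
        (∀ z : P.diagram.leeCycles,
          (Submodule.Quotient.mk (φ z) : P'.diagram.LeeHomologyZero) = 0 →
          (Submodule.Quotient.mk z : P.diagram.LeeHomologyZero) = 0) ∧
        (∀ z : P.diagram.leeCycles, GaussDiagram.qMin z.1 ≤ GaussDiagram.qMin (φ z).1)) :
    eq_zero_of_isSmoothlySlice :=
  eq_zero_of_isSmoothlySlice_of_eq_of_isConcordant
    (HasRasmussenInvariant.eq_of_isConcordant_of_filtered h)

end SPC4Direct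

/-! ## Discharge of `HasRasmussenInvariant.reverse`: `s(rK) = s(K)` -/

section SPC4Reverse

/-- **Discharge of the named fact `HasRasmussenInvariant.reverse`: the Rasmussen invariant does
not depend on the orientation of the knot, `s(rK) = s(K)`.** If `K ≅ K'` with `K'` in regular
position reading the Gauss diagram `D` with `s(D) = s`, then `rK ≅ rK'` by the same ambient
isotopy (`SphereEmbedding.IsIsotopic.reverse`), `rK'` is in regular position reading `D.reverse`
(the same plane curve run backwards: `Knot.HasGaussDiagram.reverse_holds`), and
`s(D.reverse) = s(D)` (`GaussDiagram.rasmussenInvariant_reverse`: reversal of the base circle is an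
isomorphism of the cubes of resolutions preserving both gradings, since the orientation enters
only through the signs of the crossings, which it keeps). Rasmussen (2010), §3.5 (Khovanov and
Lee homology of a knot do not depend on its orientation); Khovanov (2000), §4.2, §7.
[cite: Rasmussen2010, §3.5] -/
theorem HasRasmussenInvariant.reverse_holds : HasRasmussenInvariant.reverse := by
  intro K s h
  obtain ⟨K', D, hK', hD, hs⟩ := h
  exact ⟨K'.reverse, D.reverse, hK'.reverse, Knot.HasGaussDiagram.reverse_holds hD,
    (GaussDiagram.rasmussenInvariant_reverse D).trans hs⟩

/-- **`s` is a concordance invariant, Rasmussen's proof verbatim, with reversal discharged**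
(arXiv math/0402131, proof of Thm. 2, §4.4): additivity (`HasRasmussenInvariant.add`), `s = 0`
for smoothly slice knots (`eq_zero_of_isSmoothlySlice`), Fox–Milnor
(`Knot.isSmoothlySlice_of_isConnectedSum_mirror_reverse`) and the mirror formula
`s(K̄) = -s(K)` (`HasRasmussenInvariant.mirror`, Prop. 3.9) imply
`HasRasmussenInvariant.eq_of_isConcordant`; invariance under reversal is now the theorem
`HasRasmussenInvariant.reverse_holds`. [cite: Rasmussen2010, Thm. 2 (proof, §4.4)] -/
theorem HasRasmussenInvariant.eq_of_isConcordant_of_facts''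
    (hadd : HasRasmussenInvariant.add) (h0 : eq_zero_of_isSmoothlySlice)
    (hFM : Knot.isSmoothlySlice_of_isConnectedSum_mirror_reverse)
    (hmirror : HasRasmussenInvariant.mirror) :
    HasRasmussenInvariant.eq_of_isConcordant :=
  HasRasmussenInvariant.eq_of_isConcordant_of_facts' hadd h0 hFM hmirror
    HasRasmussenInvariant.reverse_holds

/-- **`s` is a concordance invariant, from three named facts** (Rasmussen's proof of Thm. 2,
arXiv math/0402131 §4.4, with generic projections discharged): additivity of `s`
(`HasRasmussenInvariant.add`, Prop. 3.11), `s = 0` for smoothly slice knots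
(`eq_zero_of_isSmoothlySlice`, Thm. 1) and Fox–Milnor's "`K # (-K̄)` is slice"
(`Knot.isSmoothlySlice_of_isConnectedSum_mirror_reverse`) imply
`HasRasmussenInvariant.eq_of_isConcordant`; the Rasmussen invariant of `-K̄'` needed by
`eq_of_isConcordant_of_mirror_reverse` exists because every knot is isotopic to one in regular
position (`Knot.exists_hasGaussDiagram_of_isIsotopic_holds`, Reidemeister (1932), Kap. I §1, proved
in `GaussDiagramsRegularPosition.lean`). The discharge `eq_of_isConcordant_holds` is this theorem fed
with `add_holds`, `eq_zero_of_isSmoothlySlice_holds` and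
`isSmoothlySlice_of_isConnectedSum_mirror_reverse_holds` once they exist.
[cite: Rasmussen2010, Thm. 2 (proof, §4.4)] -/
theorem HasRasmussenInvariant.eq_of_isConcordant_of_add_of_slice_of_foxMilnor
    (hadd : HasRasmussenInvariant.add) (h0 : eq_zero_of_isSmoothlySlice)
    (hFM : Knot.isSmoothlySlice_of_isConnectedSum_mirror_reverse) :
    HasRasmussenInvariant.eq_of_isConcordant :=
  HasRasmussenInvariant.eq_of_isConcordant_of_facts hadd h0 hFM
    Knot.exists_hasGaussDiagram_of_isIsotopic_holds

/-- The same from Rasmussen's own Theorem 1 in its slice-bound form: `|s(K)| ≤ 2 g₄(K)`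
(`abs_le_two_mul_sliceGenus`), additivity (`HasRasmussenInvariant.add`) and Fox–Milnor imply
`HasRasmussenInvariant.eq_of_isConcordant`
(`eq_of_isConcordant_of_abs_le_two_mul_sliceGenus` with generic projections discharged).
Rasmussen (2010), Thm. 1, Thm. 2. [cite: Rasmussen2010, Thm. 2 (proof, §4.4)] -/
theorem HasRasmussenInvariant.eq_of_isConcordant_of_add_of_sliceBound_of_foxMilnor
    (h2g : abs_le_two_mul_sliceGenus) (hadd : HasRasmussenInvariant.add)
    (hFM : Knot.isSmoothlySlice_of_isConnectedSum_mirror_reverse) :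
    HasRasmussenInvariant.eq_of_isConcordant :=
  HasRasmussenInvariant.eq_of_isConcordant_of_abs_le_two_mul_sliceGenus h2g hadd hFM
    Knot.exists_hasGaussDiagram_of_isIsotopic_holds

end SPC4Reverse

/-! ## Route A for regular presentations (appended 2026-08-15) -/

section SPC4Regular

/-- **Additivity over regular presentations from additivity as stated.** The named fact
`HasRasmussenInvariant.add` (quantified over the corner-free presentations `Knot.IsConnectedSum` of
`BandSum.lean`) implies additivity of `s` over the printed, regular presentations
`Knot.IsRegularConnectedSum` (`SchubertRegular.lean`; a regular presentation is a presentation,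
`Knot.IsRegularConnectedSum.isConnectedSum`). Rasmussen (2010), Thm. 2 / Prop. 3.11 (arXiv
numbering), for the classical connected sum of knots. [cite: Rasmussen2010, Thm. 2] -/
theorem HasRasmussenInvariant.add_regular_of_add (hadd : HasRasmussenInvariant.add)
    {K₁ K₂ K : Knot} {s₁ s₂ : ℤ} (h₁ : K₁.HasRasmussenInvariant s₁)
    (h₂ : K₂.HasRasmussenInvariant s₂) (hK : Knot.IsRegularConnectedSum K₁ K₂ K) :
    K.HasRasmussenInvariant (s₁ + s₂) :=
  hadd h₁ h₂ hK.isConnectedSum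

/-- **Core of Route A with regular presentations.** Suppose `s` is additive over *regular*
connected sums (`hadd`), vanishes on smoothly slice knots (`h0`, the named fact
`eq_zero_of_isSmoothlySlice`) and every *regular* connected sum of a knot with the reverse of its
mirror image is smoothly slice (`hFM`, Fox–Milnor in its printed reading, the conclusion of
`Knot.isSmoothlySlice_of_isRegularConnectedSum_mirror_reverse_of…`, `BandSumFoxMilnorReduction.lean`).
If `K ~ K'` are concordant with Rasmussen invariants `s`, `s'` and `M := K'.mirror.reverse` has a
Rasmussen invariant `m`, then `s = s'`: the carrying construction gives concordant *regular normal*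
connected sums `L = K # M ~ L' = K' # M` (`Knot.exists_isRegularNormalConnectedSum_isConcordant_left`,
`BandSumConcordanceNormalRegular.lean`), which are regular connected sums
(`Knot.IsRegularNormalConnectedSum.isRegularConnectedSum`); `L'` is slice by `hFM`, hence so is `L`
(`Knot.IsConcordant.isSmoothlySlice`), and `s + m = 0 = s' + m`. Rasmussen (2010), proof of Thm. 2
(arXiv math/0402131, §4.4, p. 10: *"if `K₁` and `K₂` are concordant, then `K₁ # K̄₂` is slice, so
`0 = s(K₁ # K̄₂) = s(K₁) - s(K₂)`"*), with the connected sum taken along an embedded rectangle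
(Cromwell (2004), §4.6). [cite: Rasmussen2010, Thm. 2 (proof, §4.4)] -/
theorem HasRasmussenInvariant.eq_of_isConcordant_of_mirror_reverse_regular
    (hadd : ∀ {K₁ K₂ K : Knot} {s₁ s₂ : ℤ}, K₁.HasRasmussenInvariant s₁ →
      K₂.HasRasmussenInvariant s₂ → Knot.IsRegularConnectedSum K₁ K₂ K →
      K.HasRasmussenInvariant (s₁ + s₂))
    (h0 : eq_zero_of_isSmoothlySlice)
    (hFM : ∀ [SphereEmbedding.SmoothnessFacts] {K K' : Knot},
      Knot.IsRegularConnectedSum K K.mirror.reverse K' → K'.IsSmoothlySlice)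
    {K K' : Knot} {s s' m : ℤ} (h : K.HasRasmussenInvariant s)
    (h' : K'.HasRasmussenInvariant s') (hm : K'.mirror.reverse.HasRasmussenInvariant m)
    (hc : K.IsConcordant K') : s = s' := by
  obtain ⟨L, L', hL, hL', hLL'⟩ :=
    Knot.exists_isRegularNormalConnectedSum_isConcordant_left K'.mirror.reverse hc
  have hL's : L'.IsSmoothlySlice := hFM hL'.isRegularConnectedSum
  have hLs : L.IsSmoothlySlice := hLL'.isSmoothlySlice hL's
  have e₁ : s + m = 0 := h0 (hadd h hm hL.isRegularConnectedSum) hLs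
  have e₂ : s' + m = 0 := h0 (hadd h' hm hL'.isRegularConnectedSum) hL's
  omega

/-- **`s` is a concordance invariant, from additivity and Fox–Milnor for regular presentations.**
The named fact `HasRasmussenInvariant.eq_of_isConcordant` follows from (i) additivity of `s` over
regular connected sums, (ii) `eq_zero_of_isSmoothlySlice` and (iii) "every regular connected sum of
`K` and `-K̄ = K.mirror.reverse` is smoothly slice" (`eq_of_isConcordant_of_mirror_reverse_regular`,
the Rasmussen invariant of `-K̄'` being supplied by a regular projection of an isotopic knot,
`Knot.exists_hasGaussDiagram_of_isIsotopic_holds`). Hypotheses (i) and (iii) are implied by the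
named facts `HasRasmussenInvariant.add` and `Knot.isSmoothlySlice_of_isConnectedSum_mirror_reverse`
as stated (`HasRasmussenInvariant.add_regular_of_add`,
`Knot.isSmoothlySlice_of_isRegularConnectedSum_mirror_reverse_of_general`) and are their printed
readings. Rasmussen (2010), Thm. 1 via the proof of Thm. 2 (arXiv §4.4); Cromwell (2004), §4.6.
[cite: Rasmussen2010, Thm. 2 (proof, §4.4)] -/
theorem HasRasmussenInvariant.eq_of_isConcordant_of_regular
    (hadd : ∀ {K₁ K₂ K : Knot} {s₁ s₂ : ℤ}, K₁.HasRasmussenInvariant s₁ →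
      K₂.HasRasmussenInvariant s₂ → Knot.IsRegularConnectedSum K₁ K₂ K →
      K.HasRasmussenInvariant (s₁ + s₂))
    (h0 : eq_zero_of_isSmoothlySlice)
    (hFM : ∀ [SphereEmbedding.SmoothnessFacts] {K K' : Knot},
      Knot.IsRegularConnectedSum K K.mirror.reverse K' → K'.IsSmoothlySlice) :
    HasRasmussenInvariant.eq_of_isConcordant := by
  intro K K' s s' h h' hc
  obtain ⟨M', D, hM', hD⟩ := Knot.exists_hasGaussDiagram_of_isIsotopic_holds K'.mirror.reverse
  exact HasRasmussenInvariant.eq_of_isConcordant_of_mirror_reverse_regular hadd h0 hFM h h'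
    ⟨M', D, hM', hD, rfl⟩ hc

/-- The same with Rasmussen's slice bound `|s(K)| ≤ 2 g₄(K)` (`abs_le_two_mul_sliceGenus`, Thm. 1)
in place of `eq_zero_of_isSmoothlySlice` (its case `g₄ = 0`,
`eq_zero_of_isSmoothlySlice_of_abs_le_two_mul_sliceGenus`, `RasmussenProofs.lean`).
Rasmussen (2010), Thm. 1, Thm. 2. [cite: Rasmussen2010, Thm. 2 (proof, §4.4)] -/
theorem HasRasmussenInvariant.eq_of_isConcordant_of_regular'
    (h2g : abs_le_two_mul_sliceGenus)
    (hadd : ∀ {K₁ K₂ K : Knot} {s₁ s₂ : ℤ}, K₁.HasRasmussenInvariant s₁ →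
      K₂.HasRasmussenInvariant s₂ → Knot.IsRegularConnectedSum K₁ K₂ K →
      K.HasRasmussenInvariant (s₁ + s₂))
    (hFM : ∀ [SphereEmbedding.SmoothnessFacts] {K K' : Knot},
      Knot.IsRegularConnectedSum K K.mirror.reverse K' → K'.IsSmoothlySlice) :
    HasRasmussenInvariant.eq_of_isConcordant :=
  HasRasmussenInvariant.eq_of_isConcordant_of_regular hadd
    (eq_zero_of_isSmoothlySlice_of_abs_le_two_mul_sliceGenus h2g) hFM

/-- **The regular route recovers the three-fact reduction**: fed with the named facts as stated
(additivity over corner-free presentations, `eq_zero_of_isSmoothlySlice`, Fox–Milnor over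
corner-free presentations), `eq_of_isConcordant_of_regular` gives
`HasRasmussenInvariant.eq_of_isConcordant` again (compare
`eq_of_isConcordant_of_add_of_slice_of_foxMilnor`), which shows that its hypotheses are the weaker
ones. [cite: Rasmussen2010, Thm. 2 (proof, §4.4)] -/
theorem HasRasmussenInvariant.eq_of_isConcordant_of_add_of_slice_of_foxMilnor'
    (hadd : HasRasmussenInvariant.add) (h0 : eq_zero_of_isSmoothlySlice)
    (hFM : Knot.isSmoothlySlice_of_isConnectedSum_mirror_reverse) :
    HasRasmussenInvariant.eq_of_isConcordant :=
  HasRasmussenInvariant.eq_of_isConcordant_of_regular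
    (fun h₁ h₂ hK ↦ HasRasmussenInvariant.add_regular_of_add hadd h₁ h₂ hK) h0
    (fun hK ↦ hFM hK.isConnectedSum)

end SPC4Regular

/-! ## Route B at the chain level (appended 2026-08-15) -/

section SPC4Canonical

/-- **The assembly of Rasmussen's direct argument, chain level.** Suppose that for every
concordance `K ~ K'` between knots in regular position `P`, `P'` there is a linear map of
degree-zero Lee chains `F : C⁰(P.diagram) → C⁰(P'.diagram)` which (i) maps cycles to cycles and
(ii) boundaries to boundaries (as a chain map does), (iii) does not decrease the filtration degree
`qMin` (*"`φ_S` is a filtered map of degree `χ(S)`"* `= 0`, Rasmussen (2010), §4.2, eq. (4.1)),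
and (iv) sends the canonical generator of each canonical state of `P.diagram` to a nonzero
multiple of the canonical generator of a canonical state of `P'.diagram` modulo boundaries,
injectively on canonical states (the claim in the proof of Prop. 4.1 for a connected cobordism
between knots: `φ_S([𝔰_o])` is a nonzero multiple of `[𝔰_{o'}]`). In Rasmussen's proof `F` is the
chain map `φ_S` of the concordance annulus `S`, composed from the elementary maps of a movie of
Reidemeister and Morse moves (§4.1–4.3, §6). Then concordant knots have the same Rasmussen
invariant, i.e. the named fact `HasRasmussenInvariant.eq_of_isConcordant` holds: by Corollary 4.2
in the form `GaussDiagram.mk_eq_zero_of_canonical` (`RasmussenSliceCanonicalProofs.lean`, resting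
on Lee's theorem for the diagram `P.diagram` of the knot `K`) the induced map on cycles kills no
nonzero homology class, so `eq_of_isConcordant_of_filtered` applies; one map per concordance
suffices since concordance is symmetric. This is the interface of
`eq_zero_of_isSmoothlySlice_of_canonical` (same file) with an arbitrary knot in regular position
in place of the crossingless unknot. Rasmussen (2010), Thm. 1, §4.2, Prop. 4.1, Cor. 4.2
(arXiv:math/0402131, pp. 8–10); Lee (2005), Thm. 4.2. [cite: Rasmussen2010, Cor. 4.2] -/
theorem HasRasmussenInvariant.eq_of_isConcordant_of_canonical
    (h : ∀ {K K' : Knot} (P : K.RegularProjection) (P' : K'.RegularProjection),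
      K.IsConcordant K' →
      ∃ F : (P.diagram.degStates 0 → ℚ) →ₗ[ℚ] (P'.diagram.degStates 0 → ℚ),
        (∀ z ∈ P.diagram.leeCycles, F z ∈ P'.diagram.leeCycles) ∧
        (∀ y, F (P.diagram.khovanovD ℚ 0 1 (0 - 1) 0 y) ∈
          LinearMap.range (P'.diagram.khovanovD ℚ 0 1 (0 - 1) 0)) ∧
        (∀ x, GaussDiagram.qMin x ≤ GaussDiagram.qMin (F x)) ∧
        ∃ e : {s : P.diagram.degStates 0 // ∀ i, ¬ P.diagram.Free s.1.label i} →
            {u : P'.diagram.degStates 0 // ∀ i, ¬ P'.diagram.Free u.1.label i},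
          Function.Injective e ∧ ∀ s, ∃ c : ℚ, c ≠ 0 ∧
            F ((P.diagram.leeCoord 0).symm (Pi.single s.1 1)) -
                c • (P'.diagram.leeCoord 0).symm (Pi.single (e s).1 1) ∈
              LinearMap.range (P'.diagram.khovanovD ℚ 0 1 (0 - 1) 0)) :
    HasRasmussenInvariant.eq_of_isConcordant := by
  refine HasRasmussenInvariant.eq_of_isConcordant_of_filtered fun {K K'} P P' hc ↦ ?_
  obtain ⟨F, hFB, hFA, hFq, e, he, htrack⟩ := h P P' hc
  have hG : ∃ K₁ : Knot, K₁.HasGaussDiagram P.diagram := ⟨K, P, rfl⟩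
  exact ⟨fun z ↦ ⟨F z, hFB z z.2⟩,
    GaussDiagram.mk_eq_zero_of_canonical hG F hFB hFA e he htrack, fun z ↦ hFq z.1⟩

/-- **Slice knots have `s = 0`, from the chain maps of concordances.** Under the hypothesis of
`HasRasmussenInvariant.eq_of_isConcordant_of_canonical` the named fact `eq_zero_of_isSmoothlySlice`
holds as well (a smoothly slice knot is concordant to the unknot, which has `s = 0`:
`eq_zero_of_isSmoothlySlice_of_eq_of_isConcordant`, `RasmussenProofs.lean`); compare
`eq_zero_of_isSmoothlySlice_of_canonical` (`RasmussenSliceCanonicalProofs.lean`), which asks for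
maps to and from the crossingless unknot diagram only, but in both directions.
Rasmussen (2010), Thm. 1 (case `g = 0`), §4.4. [cite: Rasmussen2010, Thm. 1] -/
theorem eq_zero_of_isSmoothlySlice_of_canonical'
    (h : ∀ {K K' : Knot} (P : K.RegularProjection) (P' : K'.RegularProjection),
      K.IsConcordant K' →
      ∃ F : (P.diagram.degStates 0 → ℚ) →ₗ[ℚ] (P'.diagram.degStates 0 → ℚ),
        (∀ z ∈ P.diagram.leeCycles, F z ∈ P'.diagram.leeCycles) ∧
        (∀ y, F (P.diagram.khovanovD ℚ 0 1 (0 - 1) 0 y) ∈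
          LinearMap.range (P'.diagram.khovanovD ℚ 0 1 (0 - 1) 0)) ∧
        (∀ x, GaussDiagram.qMin x ≤ GaussDiagram.qMin (F x)) ∧
        ∃ e : {s : P.diagram.degStates 0 // ∀ i, ¬ P.diagram.Free s.1.label i} →
            {u : P'.diagram.degStates 0 // ∀ i, ¬ P'.diagram.Free u.1.label i},
          Function.Injective e ∧ ∀ s, ∃ c : ℚ, c ≠ 0 ∧
            F ((P.diagram.leeCoord 0).symm (Pi.single s.1 1)) -
                c • (P'.diagram.leeCoord 0).symm (Pi.single (e s).1 1) ∈
              LinearMap.range (P'.diagram.khovanovD ℚ 0 1 (0 - 1) 0)) :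
    eq_zero_of_isSmoothlySlice :=
  eq_zero_of_isSmoothlySlice_of_eq_of_isConcordant
    (HasRasmussenInvariant.eq_of_isConcordant_of_canonical h)

end SPC4Canonical

/-! ## Route A in normal position; additivity in existential form (appended 2026-08-15) -/

section SPC4Normal

/-- **Additivity over regular normal presentations from additivity as stated.** The named fact
`HasRasmussenInvariant.add` (corner-free presentations `Knot.IsConnectedSum`) implies additivity of
`s` over the regular normal presentations `Knot.IsRegularNormalConnectedSum`
(`SchubertRegular.lean`: northern/southern isotopic copies of the summands, a regular band
crossing the equator in its middle segment), a regular normal presentation being a regular one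
(`Knot.IsRegularNormalConnectedSum.isRegularConnectedSum`) and a regular one a corner-free one.
Rasmussen (2010), Thm. 2 / Prop. 3.11 (arXiv numbering). [cite: Rasmussen2010, Thm. 2] -/
theorem HasRasmussenInvariant.add_regularNormal_of_add (hadd : HasRasmussenInvariant.add)
    {K₁ K₂ K : Knot} {s₁ s₂ : ℤ} (h₁ : K₁.HasRasmussenInvariant s₁)
    (h₂ : K₂.HasRasmussenInvariant s₂) (hK : Knot.IsRegularNormalConnectedSum K₁ K₂ K) :
    K.HasRasmussenInvariant (s₁ + s₂) :=
  hadd h₁ h₂ hK.isRegularConnectedSum.isConnectedSum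

/-- **Core of Route A with regular normal presentations.** As
`eq_of_isConcordant_of_mirror_reverse_regular`, with additivity (`hadd`) and Fox–Milnor (`hFM`)
assumed for *regular normal* presentations only — the reading of Fox–Milnor's Lemma 3 that
`BandSumFoxMilnorReduction.lean` reduces to the symmetric union and Schubert's theorem in normal
position with **no Schoenflies theorem**
(`Knot.isSmoothlySlice_of_isRegularNormalConnectedSum_mirror_reverse_of_normalPosition_regular`).
If `K ~ K'` have Rasmussen invariants `s`, `s'` and `M := K'.mirror.reverse` has a Rasmussen
invariant `m`, then `s = s'`: the carrying construction
(`Knot.exists_isRegularNormalConnectedSum_isConcordant_left`, proved) gives concordant regular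
normal presentations `L = K # M ~ L' = K' # M`; `L'` is slice by `hFM`, hence so is `L`
(`Knot.IsConcordant.isSmoothlySlice`), and `s + m = 0 = s' + m` by `hadd` and `h0`.
Rasmussen (2010), proof of Thm. 2 (arXiv math/0402131, §4.4, p. 10); Fox–Milnor (1966), §3
Lemma 3; Cromwell (2004), §4.6. [cite: Rasmussen2010, Thm. 2 (proof, §4.4)] -/
theorem HasRasmussenInvariant.eq_of_isConcordant_of_mirror_reverse_regularNormal
    (hadd : ∀ {K₁ K₂ K : Knot} {s₁ s₂ : ℤ}, K₁.HasRasmussenInvariant s₁ →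
      K₂.HasRasmussenInvariant s₂ → Knot.IsRegularNormalConnectedSum K₁ K₂ K →
      K.HasRasmussenInvariant (s₁ + s₂))
    (h0 : eq_zero_of_isSmoothlySlice)
    (hFM : ∀ [SphereEmbedding.SmoothnessFacts] {K K' : Knot},
      Knot.IsRegularNormalConnectedSum K K.mirror.reverse K' → K'.IsSmoothlySlice)
    {K K' : Knot} {s s' m : ℤ} (h : K.HasRasmussenInvariant s)
    (h' : K'.HasRasmussenInvariant s') (hm : K'.mirror.reverse.HasRasmussenInvariant m)
    (hc : K.IsConcordant K') : s = s' := by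
  obtain ⟨L, L', hL, hL', hLL'⟩ :=
    Knot.exists_isRegularNormalConnectedSum_isConcordant_left K'.mirror.reverse hc
  have hL's : L'.IsSmoothlySlice := hFM hL'
  have hLs : L.IsSmoothlySlice := hLL'.isSmoothlySlice hL's
  have e₁ : s + m = 0 := h0 (hadd h hm hL) hLs
  have e₂ : s' + m = 0 := h0 (hadd h' hm hL') hL's
  omega

/-- **`s` is a concordance invariant, from additivity and Fox–Milnor for regular normal
presentations** and `eq_zero_of_isSmoothlySlice` (the Rasmussen invariant of `-K̄'` being supplied
by a regular projection of an isotopic knot, `Knot.exists_hasGaussDiagram_of_isIsotopic_holds`).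
The hypotheses are implied by those of `eq_of_isConcordant_of_regular`
(`eq_of_isConcordant_of_regular_of_normal`) and a fortiori by the named facts as stated.
Rasmussen (2010), Thm. 1 via the proof of Thm. 2 (arXiv §4.4). [cite: Rasmussen2010, Thm. 2 (proof, §4.4)] -/
theorem HasRasmussenInvariant.eq_of_isConcordant_of_regularNormal
    (hadd : ∀ {K₁ K₂ K : Knot} {s₁ s₂ : ℤ}, K₁.HasRasmussenInvariant s₁ →
      K₂.HasRasmussenInvariant s₂ → Knot.IsRegularNormalConnectedSum K₁ K₂ K →
      K.HasRasmussenInvariant (s₁ + s₂))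
    (h0 : eq_zero_of_isSmoothlySlice)
    (hFM : ∀ [SphereEmbedding.SmoothnessFacts] {K K' : Knot},
      Knot.IsRegularNormalConnectedSum K K.mirror.reverse K' → K'.IsSmoothlySlice) :
    HasRasmussenInvariant.eq_of_isConcordant := by
  intro K K' s s' h h' hc
  obtain ⟨M', D, hM', hD⟩ := Knot.exists_hasGaussDiagram_of_isIsotopic_holds K'.mirror.reverse
  exact HasRasmussenInvariant.eq_of_isConcordant_of_mirror_reverse_regularNormal hadd h0 hFM h h'
    ⟨M', D, hM', hD, rfl⟩ hc

/-- The hypotheses of the regular route (`eq_of_isConcordant_of_regular`: additivity and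
Fox–Milnor over all regular presentations) imply those of the regular normal route, which
therefore recovers it. [cite: Rasmussen2010, Thm. 2 (proof, §4.4)] -/
theorem HasRasmussenInvariant.eq_of_isConcordant_of_regular_of_normal
    (hadd : ∀ {K₁ K₂ K : Knot} {s₁ s₂ : ℤ}, K₁.HasRasmussenInvariant s₁ →
      K₂.HasRasmussenInvariant s₂ → Knot.IsRegularConnectedSum K₁ K₂ K →
      K.HasRasmussenInvariant (s₁ + s₂))
    (h0 : eq_zero_of_isSmoothlySlice)
    (hFM : ∀ [SphereEmbedding.SmoothnessFacts] {K K' : Knot},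
      Knot.IsRegularConnectedSum K K.mirror.reverse K' → K'.IsSmoothlySlice) :
    HasRasmussenInvariant.eq_of_isConcordant :=
  HasRasmussenInvariant.eq_of_isConcordant_of_regularNormal
    (fun h₁ h₂ hK ↦ hadd h₁ h₂ hK.isRegularConnectedSum) h0
    (fun hK ↦ hFM hK.isRegularConnectedSum)

/-! ### Additivity in existential form

`Knot.HasRasmussenInvariant K s` quantifies over isotopic representatives in regular position, so
it is closed under isotopy of `K` by definition (`Knot.HasRasmussenInvariant.of_isIsotopic`). Hence,
granted Schubert's theorem in normal position for regular presentations
(`Knot.Schubert1949_normalPosition_regular`, under which two regular normal presentations with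
isotopic summands are isotopic, `Knot.IsRegularNormalConnectedSum.isIsotopic_of_normalPosition_regular`,
proved), additivity of `s` over *all* regular normal presentations of `K₁ # K₂` is equivalent to
its **existential form**: *some* regular normal presentation of `K₁ # K₂` has Rasmussen invariant
`s₁ + s₂`. The existential form is what the printed proof of Prop. 3.11 delivers — `s` of ONE
diagram of `K₁ # K₂` drawn from diagrams of `K₁` and `K₂` (arXiv math/0402131, Lemma 3.8 and
Prop. 3.11, p. 7: the short exact sequence of "the diagram for `K₁ # K₂` shown in Figure 3") —
and it involves neither Schubert's theorem nor the Reidemeister invariance of `s`. Since the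
regular normal reading of Fox–Milnor rests on the same theorem of Schubert
(`BandSumFoxMilnorReduction.lean`), Route A in normal position needs additivity in existential
form only. -/

/-- **Existential additivity from additivity over regular normal presentations**: regular normal
presentations exist (the carrying construction along the trivial concordance,
`Knot.exists_isRegularNormalConnectedSum_isConcordant_left … (Knot.IsConcordant.refl' _)`).
[cite: Rasmussen2010, Prop. 3.11 (arXiv numbering)] -/
theorem HasRasmussenInvariant.exists_add_of_add_regularNormal
    (hadd : ∀ {K₁ K₂ K : Knot} {s₁ s₂ : ℤ}, K₁.HasRasmussenInvariant s₁ →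
      K₂.HasRasmussenInvariant s₂ → Knot.IsRegularNormalConnectedSum K₁ K₂ K →
      K.HasRasmussenInvariant (s₁ + s₂))
    {K₁ K₂ : Knot} {s₁ s₂ : ℤ} (h₁ : K₁.HasRasmussenInvariant s₁)
    (h₂ : K₂.HasRasmussenInvariant s₂) :
    ∃ L : Knot, Knot.IsRegularNormalConnectedSum K₁ K₂ L ∧ L.HasRasmussenInvariant (s₁ + s₂) := by
  obtain ⟨L, -, hL, -, -⟩ :=
    Knot.exists_isRegularNormalConnectedSum_isConcordant_left K₂ (Knot.IsConcordant.refl' K₁)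
  exact ⟨L, hL, hadd h₁ h₂ hL⟩

/-- **Existential additivity from the named fact `HasRasmussenInvariant.add` as stated.**
[cite: Rasmussen2010, Thm. 2] -/
theorem HasRasmussenInvariant.exists_add_of_add (hadd : HasRasmussenInvariant.add)
    {K₁ K₂ : Knot} {s₁ s₂ : ℤ} (h₁ : K₁.HasRasmussenInvariant s₁)
    (h₂ : K₂.HasRasmussenInvariant s₂) :
    ∃ L : Knot, Knot.IsRegularNormalConnectedSum K₁ K₂ L ∧ L.HasRasmussenInvariant (s₁ + s₂) :=
  HasRasmussenInvariant.exists_add_of_add_regularNormal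
    (fun h₁ h₂ hK ↦ HasRasmussenInvariant.add_regularNormal_of_add hadd h₁ h₂ hK) h₁ h₂

/-- **Additivity over all regular normal presentations from existential additivity and Schubert's
theorem in normal position** (`hH`, `Knot.Schubert1949_normalPosition_regular`): a second regular
normal presentation `K` of `K₁ # K₂` is isotopic to the one, `L`, carrying the invariant
(`Knot.IsRegularNormalConnectedSum.isIsotopic_of_normalPosition_regular`), and
`Knot.HasRasmussenInvariant` is closed under isotopy (`Knot.HasRasmussenInvariant.of_isIsotopic`).
Rasmussen (2010), Prop. 3.11; Cromwell (2004), §4.6 (the product is independent of the choices).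
[cite: Rasmussen2010, Prop. 3.11 (arXiv numbering)] -/
theorem HasRasmussenInvariant.add_regularNormal_of_exists_add_of_normalPosition_regular
    (hadd : ∀ {K₁ K₂ : Knot} {s₁ s₂ : ℤ}, K₁.HasRasmussenInvariant s₁ →
      K₂.HasRasmussenInvariant s₂ →
      ∃ L : Knot, Knot.IsRegularNormalConnectedSum K₁ K₂ L ∧ L.HasRasmussenInvariant (s₁ + s₂))
    (hH : Knot.Schubert1949_normalPosition_regular)
    {K₁ K₂ K : Knot} {s₁ s₂ : ℤ} (h₁ : K₁.HasRasmussenInvariant s₁)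
    (h₂ : K₂.HasRasmussenInvariant s₂) (hK : Knot.IsRegularNormalConnectedSum K₁ K₂ K) :
    K.HasRasmussenInvariant (s₁ + s₂) := by
  obtain ⟨L, hL, hLs⟩ := hadd h₁ h₂
  exact hLs.of_isIsotopic (hK.isIsotopic_of_normalPosition_regular hH hL)

/-- **Route A in normal position, assembled**: the named fact
`HasRasmussenInvariant.eq_of_isConcordant` from (i) additivity in existential form, (ii)
`eq_zero_of_isSmoothlySlice`, (iii) Fox–Milnor for regular normal presentations and (iv) Schubert's
theorem in normal position for regular presentations (`Knot.Schubert1949_normalPosition_regular`,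
the named fact (iii) is itself reduced to in `BandSumFoxMilnorReduction.lean`).
Rasmussen (2010), proof of Thm. 2 (arXiv §4.4); Fox–Milnor (1966), §3 Lemma 3; Cromwell (2004),
§4.6. [cite: Rasmussen2010, Thm. 2 (proof, §4.4)] -/
theorem HasRasmussenInvariant.eq_of_isConcordant_of_exists_add_of_normalPosition_regular
    (hadd : ∀ {K₁ K₂ : Knot} {s₁ s₂ : ℤ}, K₁.HasRasmussenInvariant s₁ →
      K₂.HasRasmussenInvariant s₂ →
      ∃ L : Knot, Knot.IsRegularNormalConnectedSum K₁ K₂ L ∧ L.HasRasmussenInvariant (s₁ + s₂))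
    (h0 : eq_zero_of_isSmoothlySlice)
    (hFM : ∀ [SphereEmbedding.SmoothnessFacts] {K K' : Knot},
      Knot.IsRegularNormalConnectedSum K K.mirror.reverse K' → K'.IsSmoothlySlice)
    (hH : Knot.Schubert1949_normalPosition_regular) :
    HasRasmussenInvariant.eq_of_isConcordant :=
  HasRasmussenInvariant.eq_of_isConcordant_of_regularNormal
    (fun h₁ h₂ hK ↦
      HasRasmussenInvariant.add_regularNormal_of_exists_add_of_normalPosition_regular hadd hH h₁ h₂ hK)
    h0 hFM

/-- **Route A in normal position, fully reduced**: the named fact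
`HasRasmussenInvariant.eq_of_isConcordant` from (i) additivity in existential form, (ii)
`eq_zero_of_isSmoothlySlice`, (A) *some* regular normal presentation of `K # K.mirror.reverse` is
smoothly slice, for every `K` (the symmetric union of Fox–Milnor's proof of Lemma 3, the
hypothesis `hA` of `BandSumFoxMilnorReduction.lean`, written out as there) and (iv) Schubert's
theorem in normal position for regular presentations, (A) and (iv) giving Fox–Milnor for regular
normal presentations
(`Knot.isSmoothlySlice_of_isRegularNormalConnectedSum_mirror_reverse_of_normalPosition_regular`).
Upstream set of the fact along this route: existential additivity (Prop. 3.11 for one diagram of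
the connected sum), `eq_zero_of_isSmoothlySlice` (Thm. 1), the symmetric union (A), and the single
named fact `Knot.Schubert1949_normalPosition_regular` (equivalently
`Knot.Schubert1949_normalPosition_rebuilt`, `…_of_rebuilt` below). Rasmussen (2010), proof of
Thm. 2 (arXiv §4.4); Fox–Milnor (1966), §3 Lemma 3 (p. 263); Cromwell (2004), §4.6.
[cite: Rasmussen2010, Thm. 2 (proof, §4.4)] -/
theorem HasRasmussenInvariant.eq_of_isConcordant_of_exists_add_of_symmetric_of_normalPosition_regular
    (hadd : ∀ {K₁ K₂ : Knot} {s₁ s₂ : ℤ}, K₁.HasRasmussenInvariant s₁ →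
      K₂.HasRasmussenInvariant s₂ →
      ∃ L : Knot, Knot.IsRegularNormalConnectedSum K₁ K₂ L ∧ L.HasRasmussenInvariant (s₁ + s₂))
    (h0 : eq_zero_of_isSmoothlySlice)
    (hA : ∀ [SphereEmbedding.SmoothnessFacts] (K : Knot),
      ∃ K₀ : Knot, Knot.IsRegularNormalConnectedSum K K.mirror.reverse K₀ ∧ K₀.IsSmoothlySlice)
    (hH : Knot.Schubert1949_normalPosition_regular) :
    HasRasmussenInvariant.eq_of_isConcordant :=
  HasRasmussenInvariant.eq_of_isConcordant_of_exists_add_of_normalPosition_regular hadd h0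
    (Knot.isSmoothlySlice_of_isRegularNormalConnectedSum_mirror_reverse_of_normalPosition_regular
      hA hH)
    hH

/-- The same with the heart `Knot.Schubert1949_normalPosition_rebuilt` (`SchubertNormalForm.lean`)
for (iv): the printed band fact being proved (`BandData.isIsotopic_of_band_eq_of_isRegular_holds`,
`BandSumIsotopyRegularProofs.lean`), the heart gives Schubert's theorem in normal position for
regular presentations (`Knot.Schubert1949_normalPosition_regular_of_rebuilt`, `SchubertRegular.lean`).
[cite: Rasmussen2010, Thm. 2 (proof, §4.4)] -/
theorem HasRasmussenInvariant.eq_of_isConcordant_of_exists_add_of_symmetric_of_rebuilt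
    (hadd : ∀ {K₁ K₂ : Knot} {s₁ s₂ : ℤ}, K₁.HasRasmussenInvariant s₁ →
      K₂.HasRasmussenInvariant s₂ →
      ∃ L : Knot, Knot.IsRegularNormalConnectedSum K₁ K₂ L ∧ L.HasRasmussenInvariant (s₁ + s₂))
    (h0 : eq_zero_of_isSmoothlySlice)
    (hA : ∀ [SphereEmbedding.SmoothnessFacts] (K : Knot),
      ∃ K₀ : Knot, Knot.IsRegularNormalConnectedSum K K.mirror.reverse K₀ ∧ K₀.IsSmoothlySlice)
    (hR : Knot.Schubert1949_normalPosition_rebuilt) :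
    HasRasmussenInvariant.eq_of_isConcordant :=
  HasRasmussenInvariant.eq_of_isConcordant_of_exists_add_of_symmetric_of_normalPosition_regular
    hadd h0 hA
    (Knot.Schubert1949_normalPosition_regular_of_rebuilt
      BandData.isIsotopic_of_band_eq_of_isRegular_holds hR)

/-- The same with Rasmussen's slice bound `|s(K)| ≤ 2 g₄(K)` (`abs_le_two_mul_sliceGenus`, Thm. 1)
for (ii) (its case `g₄ = 0`, `eq_zero_of_isSmoothlySlice_of_abs_le_two_mul_sliceGenus`,
`RasmussenProofs.lean`). [cite: Rasmussen2010, Thm. 1, Thm. 2] -/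
theorem HasRasmussenInvariant.eq_of_isConcordant_of_exists_add_of_sliceBound_of_symmetric_of_rebuilt
    (hadd : ∀ {K₁ K₂ : Knot} {s₁ s₂ : ℤ}, K₁.HasRasmussenInvariant s₁ →
      K₂.HasRasmussenInvariant s₂ →
      ∃ L : Knot, Knot.IsRegularNormalConnectedSum K₁ K₂ L ∧ L.HasRasmussenInvariant (s₁ + s₂))
    (h2g : abs_le_two_mul_sliceGenus)
    (hA : ∀ [SphereEmbedding.SmoothnessFacts] (K : Knot),
      ∃ K₀ : Knot, Knot.IsRegularNormalConnectedSum K K.mirror.reverse K₀ ∧ K₀.IsSmoothlySlice)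
    (hR : Knot.Schubert1949_normalPosition_rebuilt) :
    HasRasmussenInvariant.eq_of_isConcordant :=
  HasRasmussenInvariant.eq_of_isConcordant_of_exists_add_of_symmetric_of_rebuilt hadd
    (eq_zero_of_isSmoothlySlice_of_abs_le_two_mul_sliceGenus h2g) hA hR

/-- **Sanity check: the named facts as stated feed the normal route.** Additivity as stated gives
existential additivity (`exists_add_of_add`) and the corner-free Fox–Milnor fact gives its regular
normal reading (`Knot.isSmoothlySlice_of_isRegularNormalConnectedSum_mirror_reverse_of_general`), so
with Schubert's theorem in normal position the three-fact reduction
`eq_of_isConcordant_of_add_of_slice_of_foxMilnor` is recovered once more.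
[cite: Rasmussen2010, Thm. 2 (proof, §4.4)] -/
theorem HasRasmussenInvariant.eq_of_isConcordant_of_add_of_slice_of_foxMilnor_of_normalPosition_regular
    (hadd : HasRasmussenInvariant.add) (h0 : eq_zero_of_isSmoothlySlice)
    (hFM : Knot.isSmoothlySlice_of_isConnectedSum_mirror_reverse)
    (hH : Knot.Schubert1949_normalPosition_regular) :
    HasRasmussenInvariant.eq_of_isConcordant :=
  HasRasmussenInvariant.eq_of_isConcordant_of_exists_add_of_normalPosition_regular
    (fun h₁ h₂ ↦ HasRasmussenInvariant.exists_add_of_add hadd h₁ h₂) h0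
    (Knot.isSmoothlySlice_of_isRegularNormalConnectedSum_mirror_reverse_of_general hFM) hH

end SPC4Normal

/-! ## The mirror image: discharge of `HasRasmussenInvariant.mirror` -/

section SPC4Mirror

/-- **Discharge of the named fact `HasRasmussenInvariant.mirror`: `s(K̄) = -s(K)`** (Rasmussen
(2010), §3.2, Prop. 3.9 of arXiv math/0402131 = behaviour under mirror image, used in the proof of
Thm. 2). If `K ≅ K'` with `K'` in regular position reading the Gauss diagram `D` with `s(D) = s`,
then `K̄ ≅ K̄'` by the mirrored ambient isotopy (`SphereEmbedding.IsIsotopic.mirror`), `K̄'` is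
isotopic to a knot `K''` in regular position reading the mirrored diagram `D.mirror` (reflection in
the height coordinate of the projection followed by a half-turn of `S³`:
`Knot.HasGaussDiagram.mirror_holds`, `GaussDiagramsMirrorProofs.lean`), and
`s(D.mirror) = -s(D)` for the realisable diagram `D` (`GaussDiagram.rasmussenInvariant_mirror_holds`,
`LeeRasmussenMirrorDischarge.lean`: the Lee complex of the mirror is the filtered dual, Prop. 3.9,
with Lee's rank-two theorem and `s_max = s_min + 2`). Transitivity of isotopy is the instance
`SphereEmbedding.isotopyFacts`. Rasmussen (2010), Prop. 3.9 (arXiv numbering; §3.5 of the fact's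
docstring). [cite: Rasmussen2010, Prop. 3.9] -/
theorem HasRasmussenInvariant.mirror_holds : HasRasmussenInvariant.mirror := by
  intro K s h
  obtain ⟨K', D, hK', hD, hs⟩ := h
  obtain ⟨K'', hK'', hD''⟩ := Knot.HasGaussDiagram.mirror_holds hD
  exact ⟨K'', D.mirror, SphereEmbedding.IsotopyFacts.trans hK'.mirror hK'', hD'',
    (GaussDiagram.rasmussenInvariant_mirror_holds (G := D) ⟨K', hD⟩).trans (by rw [hs])⟩

/-- **The concordance inverse has the opposite invariant: `s(-K̄) = s(rK̄) = -s(K)`** (mirror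
image with reversed orientation, the inverse of `K` in `Conc(S³)`), from the two discharged facts
`HasRasmussenInvariant.mirror_holds` and `HasRasmussenInvariant.reverse_holds`. This is the value
`m = -s'` fed to the core step `eq_of_isConcordant_of_mirror_reverse` of Route A, turning its
conclusion into the printed `0 = s(K # -K̄') = s(K) - s(K')`. Rasmussen (2010), §3.2 and proof of
Thm. 2 (arXiv §4.4). [cite: Rasmussen2010, Prop. 3.9] -/
theorem HasRasmussenInvariant.mirror_reverse {K : Knot} {s : ℤ} (h : K.HasRasmussenInvariant s) :
    K.mirror.reverse.HasRasmussenInvariant (-s) :=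
  HasRasmussenInvariant.reverse_holds (HasRasmussenInvariant.mirror_holds h)

end SPC4Mirror

/-! ## Route A through the diagrammatic additivity: what the geometric realisation must supply -/

section SPC4Realisation

/-- **Existential additivity from the diagrammatic additivity and a geometric realisation of the
connected sum of diagrams.** The diagrammatic half of Rasmussen's Prop. 3.11 is the tree's theorem
`GaussDiagram.rasmussenInvariant_connSum'` (`LeeRasmussenConnSumProofs`: `s(D₁ # D₂) = s(D₁) + s(D₂)`
for the concatenation `GaussDiagram.connSum` of based Gauss diagrams with Gauss parity). The
geometric half is the hypothesis `hA4`: knots in regular position reading `D₁`, `D₂` have a regular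
normal connected sum isotopic to a knot in regular position reading `D₁ # D₂` (shrink the two knots
into the northern and southern hemispheres by projection-compatible conformal maps and join the two
base arcs by a flat band across the equator — Rolfsen (1976), §2.G; Chmutov–Duzhin–Mostovoy (2012),
§1.7.2: cutting at the base points makes the connected sum a concatenation). Given both,
`s` is additive in the existential form consumed by
`eq_of_isConcordant_of_exists_add_of_symmetric_of_normalPosition_regular`: *some* regular normal
presentation of `K₁ # K₂` has Rasmussen invariant `s₁ + s₂`. Rasmussen (2010), Prop. 3.11.
[cite: Rasmussen2010, Prop. 3.11] -/
theorem HasRasmussenInvariant.exists_add_of_realisation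
    (hA4 : ∀ {K₁ K₂ : Knot} (P₁ : K₁.RegularProjection) (P₂ : K₂.RegularProjection),
      ∃ L L' : Knot, Knot.IsRegularNormalConnectedSum K₁ K₂ L ∧ L.IsIsotopic L' ∧
        L'.HasGaussDiagram (P₁.diagram.connSum P₂.diagram))
    {K₁ K₂ : Knot} {s₁ s₂ : ℤ} (h₁ : K₁.HasRasmussenInvariant s₁) (h₂ : K₂.HasRasmussenInvariant s₂) :
    ∃ L : Knot, Knot.IsRegularNormalConnectedSum K₁ K₂ L ∧ L.HasRasmussenInvariant (s₁ + s₂) := by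
  obtain ⟨K₁', D₁, hK₁, ⟨P₁, rfl⟩, rfl⟩ := h₁
  obtain ⟨K₂', D₂, hK₂, ⟨P₂, rfl⟩, rfl⟩ := h₂
  obtain ⟨L, L', hL, hLL', hread⟩ := hA4 P₁ P₂
  refine ⟨L, hL.of_isIsotopic (SphereEmbedding.IsIsotopic.symm_holds hK₁)
    (SphereEmbedding.IsIsotopic.symm_holds hK₂), L', _, hLL', hread, ?_⟩
  exact GaussDiagram.rasmussenInvariant_connSum' P₁.diagram P₂.diagram
    P₁.overPos_mod_two_ne_underPos_mod_two P₂.overPos_mod_two_ne_underPos_mod_two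

/-- **Route A in normal position with additivity supplied by the tree's diagrammatic theorem**: the
named fact `HasRasmussenInvariant.eq_of_isConcordant` from (A4) the geometric realisation of the
connected sum of diagrams (`hA4`, as in `exists_add_of_realisation`), (ii) `eq_zero_of_isSmoothlySlice`,
(A) the symmetric union and (iv) Schubert's theorem in normal position for regular presentations.
Of Rasmussen's inputs to the proof of Thm. 2 only the purely geometric ones remain hypotheses; the
Khovanov–Lee algebra (Prop. 3.11 for diagrams, Prop. 3.9, Lee's theorem) is proved in the tree.
Rasmussen (2010), proof of Thm. 2 (arXiv §4.4); Fox–Milnor (1966), §3 Lemma 3.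
[cite: Rasmussen2010, Thm. 2 (proof, §4.4)] -/
theorem HasRasmussenInvariant.eq_of_isConcordant_of_realisation_of_symmetric_of_normalPosition_regular
    (hA4 : ∀ {K₁ K₂ : Knot} (P₁ : K₁.RegularProjection) (P₂ : K₂.RegularProjection),
      ∃ L L' : Knot, Knot.IsRegularNormalConnectedSum K₁ K₂ L ∧ L.IsIsotopic L' ∧
        L'.HasGaussDiagram (P₁.diagram.connSum P₂.diagram))
    (h0 : eq_zero_of_isSmoothlySlice)
    (hA : ∀ [SphereEmbedding.SmoothnessFacts] (K : Knot),
      ∃ K₀ : Knot, Knot.IsRegularNormalConnectedSum K K.mirror.reverse K₀ ∧ K₀.IsSmoothlySlice)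
    (hH : Knot.Schubert1949_normalPosition_regular) :
    HasRasmussenInvariant.eq_of_isConcordant :=
  HasRasmussenInvariant.eq_of_isConcordant_of_exists_add_of_symmetric_of_normalPosition_regular
    (fun h₁ h₂ ↦ HasRasmussenInvariant.exists_add_of_realisation hA4 h₁ h₂) h0 hA hH

/-- The same with the heart `Knot.Schubert1949_normalPosition_rebuilt` for (iv) and Rasmussen's slice
bound `abs_le_two_mul_sliceGenus` for (ii). [cite: Rasmussen2010, Thm. 2 (proof, §4.4)] -/
theorem HasRasmussenInvariant.eq_of_isConcordant_of_realisation_of_sliceBound_of_symmetric_of_rebuilt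
    (hA4 : ∀ {K₁ K₂ : Knot} (P₁ : K₁.RegularProjection) (P₂ : K₂.RegularProjection),
      ∃ L L' : Knot, Knot.IsRegularNormalConnectedSum K₁ K₂ L ∧ L.IsIsotopic L' ∧
        L'.HasGaussDiagram (P₁.diagram.connSum P₂.diagram))
    (h2g : abs_le_two_mul_sliceGenus)
    (hA : ∀ [SphereEmbedding.SmoothnessFacts] (K : Knot),
      ∃ K₀ : Knot, Knot.IsRegularNormalConnectedSum K K.mirror.reverse K₀ ∧ K₀.IsSmoothlySlice)
    (hR : Knot.Schubert1949_normalPosition_rebuilt) :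
    HasRasmussenInvariant.eq_of_isConcordant :=
  HasRasmussenInvariant.eq_of_isConcordant_of_exists_add_of_sliceBound_of_symmetric_of_rebuilt
    (fun h₁ h₂ ↦ HasRasmussenInvariant.exists_add_of_realisation hA4 h₁ h₂) h2g hA hR

end SPC4Realisation

end Literature.Topology.FourManifolds
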